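import Summits.QuantumFields.BalabanUV.Gaps.EndDrawdownCooperatorExtremal

/-!
# Gaps / EndDrawdownLinearFloorEntry — A SUFFICIENT CONDITION FOR POSSIBILITY ON THE LINEAR ROAD THAT DOES NOT READ THE DRAWDOWN PROFILE:
# the FLOOR–ENTRY condition.  By `EndDrawdownCooperatorExtremal` §5, `EndPossibleLin b C γ₀` is the END of the linear cooperator `b_k + C g_k`,
# i.e. a condition on the backward orbits `z` of the clamped step map.  Two elementary facts about those orbits: (FLOOR) at a step with
# `b_i ≥ −ε`, below the level `Λ = (C∕ε)²` the help `C·ĝ_γ(z) ≥ ε` beats the rate, so `z_i ≥ min(z_{i+1}, Λ)` (`backOrbit_floor_lin`,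
# `backOrbit_tail_floor`); (ENTRY) read backward the orbit gains at least the window sums of `b` (`EndDrawdownCooperatorExtremal.backOrbit_add_sum_le`).
# Hence the FLOOR–ENTRY BOUND `backOrbit_ge_clamp_of_floorEntry`: a checkpoint `I`, a tail rate `ρ` (`b_j ≥ −ρ`, `j ≥ I`), an internal drawdown
# bound `Dint` (windows inside `[0,I]`) and an ENTRY drawdown bound `Dent` (windows ending at `I`) with `1∕γ² + Dent ≤ (C∕ρ)²` keep every orbit
# with a deep target above the clamp; so `endpointExistence_linCoop_of_floorEntry` ∕ **`endPossibleLin_of_floorEntry`**: if such data exist at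
# every level `A = 1∕γ²`, the linear cooperator — and with it the whole (AF-1) class — is POSSIBLE, for the given `C`.  Corollary
# **`endPossibleLin_of_recovering`**: a sequence with `liminf b ≥ 0` that RECOVERS infinitely often within a fixed budget (entry drawdown `≤ B` at
# infinitely many checkpoints) is possible on the linear road for EVERY `C > 0`, WHATEVER THE SIZE OF ITS DRAWDOWN PROFILE between checkpoints —
# the witness is the recovering staircase of `EndDrawdownLinearRecovering` (cell pub-balaban-gaps, seat g1-p3 GEN 10, rows CAP ∕ tail ∕ (D4)
# «split ∕ weakening»; this seat's own leaf; file 18 of «the one-loop interface of the END statement»)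

HONEST FRAMING (cell rule, page 1 of everything): [folklore] window arithmetic along backward orbits of the tree's clamped step map;
`EndPossibleLin` is a quantified READING of the cell's END-grade statement over Bałaban-free data `(b, C, γ₀)`, not a binder; the (AF-1) linear
road is a located UNPRINTED hypothesis shape ([I] (2.12)–(2.14) ∕ [II] p. 8 after (1.29); `CapSignsConstRoad` §1); NOTHING of Bałaban's table is
certified (NODE-O 0∕1, CAP coefficients 0); words ∕ odds of rows CAP ∕ tail ∕ (D4) ∕ (D1) UNCHANGED; 0∕6 binders; one finite T⁴; NOT [I] Thm 2,
NOT `BetaPertH`, NOT the continuum limit, NOT Clay.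

CITATION HEADER (tags CONTEXT ONLY).  [I] = T. Bałaban, Commun. Math. Phys. **109** (1987) 249–301 [Balaban1987RG1]: (0.20) p. 256, Thm 2
p. 259 (first sentence), (2.12)–(2.14) p. 268.
-/

namespace Summit.QuantumFields.BalabanUV.Gaps.EndDrawdownLinearFloorEntry

open Literature.MathematicalPhysics.QuantumFieldTheory.Balaban1983to89
open Literature.MathematicalPhysics.QuantumFieldTheory.Balaban1983to89.FlowStep
open Literature.MathematicalPhysics.QuantumFieldTheory.Balaban1983to89.FlowStepRuns
open Literature.MathematicalPhysics.QuantumFieldTheory.Balaban1983to89.DagBinding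
open Summit.QuantumFields.BalabanUV.Gaps.EndDrawdownLinearRoad
open Summit.QuantumFields.BalabanUV.Gaps.EndDrawdownCooperatorExtremal
open Finset

noncomputable section

/-! ## §1 The FLOOR–ENTRY bound for backward orbits of a linear cooperator -/

section Orbit

variable {b : ℕ → ℝ} {C γ : ℝ} {K : ℕ} {z : ℕ → ℝ}

/-- **THE FLOOR OF A RATE** · along a backward orbit of a linear cooperator `b_k + C g_k` (`C > 0`), at a step with `b_i ≥ −ε` (`ε > 0`) whose
floor `Λ := (C∕ε)²` lies above the clamp (`1∕γ² ≤ Λ`): `min(z_{i+1}, Λ) ≤ z_i` — below `Λ` the help `C·ĝ(z_i) ≥ C∕√Λ = ε` beats the rate. [folklore] -/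
theorem backOrbit_floor_lin (hγ : 0 < γ) (hC : 0 < C)
    (hz : ∀ i, i < K → stepMap b (fun x => C * x) γ i (z i) = z (i + 1)) {i : ℕ} (hi : i < K) {ε : ℝ} (hε : 0 < ε)
    (hb : -ε ≤ b i) (hΛ : 1 / γ ^ 2 ≤ (C / ε) ^ 2) : min (z (i + 1)) ((C / ε) ^ 2) ≤ z i := by
  by_cases hcase : (C / ε) ^ 2 ≤ z i
  · exact (min_le_right _ _).trans hcase
  · have hzi : z i ≤ (C / ε) ^ 2 := (not_le.mp hcase).le
    have hmax : max (z i) (1 / γ ^ 2) ≤ (C / ε) ^ 2 := max_le hzi hΛ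
    have hmpos : 0 < max (z i) (1 / γ ^ 2) := lt_max_of_lt_right (by positivity)
    have hsq : Real.sqrt (max (z i) (1 / γ ^ 2)) ≤ C / ε := by
      rw [← Real.sqrt_sq (show 0 ≤ C / ε by positivity)]
      exact Real.sqrt_le_sqrt hmax
    have hhelp : ε ≤ C * gClamp γ (z i) := by
      unfold gClamp
      rw [mul_one_div, le_div_iff₀ (Real.sqrt_pos.mpr hmpos)]
      calc ε * Real.sqrt (max (z i) (1 / γ ^ 2)) ≤ ε * (C / ε) := mul_le_mul_of_nonneg_left hsq hε.le
        _ = C := by field_simp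
    have h := hz i hi
    rw [stepMap_apply] at h
    have : z (i + 1) ≤ z i := by linarith
    exact (min_le_left _ _).trans this

variable (hγ : 0 < γ) (hC : 0 < C) (hz : ∀ i, i < K → stepMap b (fun x => C * x) γ i (z i) = z (i + 1))
include hγ hC hz

/-- **THE TAIL FLOOR** · if `b_j ≥ −ρ` from index `I` on (`ρ > 0`) and the floor `(C∕ρ)²` lies above the clamp, then `min(z_K, (C∕ρ)²) ≤ z_i` for
`I ≤ i ≤ K` (the floor of a rate, step by step backward from `K`). [folklore] -/
theorem backOrbit_tail_floor {I : ℕ} {ρ : ℝ} (hρ : 0 < ρ) (htail : ∀ j, I ≤ j → -ρ ≤ b j) (hΛ : 1 / γ ^ 2 ≤ (C / ρ) ^ 2) :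
    ∀ i, I ≤ i → i ≤ K → min (z K) ((C / ρ) ^ 2) ≤ z i := by
  suffices h : ∀ d i, i + d = K → I ≤ i → min (z K) ((C / ρ) ^ 2) ≤ z i from fun i hi hiK => h (K - i) i (by omega) hi
  intro d
  induction d with
  | zero => intro i hi _; rw [show i = K by omega]; exact min_le_left _ _
  | succ d ih =>
    intro i hi hI
    have hfl := backOrbit_floor_lin hγ hC hz (show i < K by omega) hρ (htail i hI) hΛ
    exact (le_min (ih (i + 1) (by omega) (by omega)) (min_le_right _ _)).trans hfl

/-- **THE FLOOR–ENTRY BOUND** · data: a checkpoint `I`, a tail rate `ρ > 0` (`b_j ≥ −ρ` for `j ≥ I`), an internal drawdown bound `Dint` for the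
windows inside `[0, I]`, an ENTRY drawdown bound `Dent` for the windows ENDING at `I`; if the tail floor clears the clamp by the entry drawdown,
`1∕γ² + Dent ≤ (C∕ρ)²`, and the target is deep, `z_K ≥ 1∕γ² + Dint` and `z_K ≥ 1∕γ² + Dent`, then the orbit stays above the clamp:
`1∕γ² ≤ z_i` for all `i ≤ K` (`K ≤ I`: the deep target absorbs the internal drawdown — `backOrbit_add_sum_le`; `K > I`: the tail sits on the floor
`≥ 1∕γ² + Dent`, and the windows into `I` cost at most `Dent`). [folklore] -/
theorem backOrbit_ge_clamp_of_floorEntry {I : ℕ} {ρ Dint Dent : ℝ} (hρ : 0 < ρ) (htail : ∀ j, I ≤ j → -ρ ≤ b j)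
    (hint : ∀ i K', i ≤ K' → K' ≤ I → -Dint ≤ ∑ j ∈ Ico i K', b j) (hent : ∀ i, i ≤ I → -Dent ≤ ∑ j ∈ Ico i I, b j)
    (hfloor : 1 / γ ^ 2 + Dent ≤ (C / ρ) ^ 2) (hYt : 1 / γ ^ 2 + Dint ≤ z K) (hYt' : 1 / γ ^ 2 + Dent ≤ z K) :
    ∀ i, i ≤ K → 1 / γ ^ 2 ≤ z i := by
  have hDent : 0 ≤ Dent := by have h := hent I le_rfl; simp at h; linarith
  have hsum := fun {i j : ℕ} (hij : i ≤ j) (hj : j ≤ K) =>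
    backOrbit_add_sum_le (b := b) (H := fun x => C * x) hγ (fun x hx _ => by positivity) hz hij hj
  intro i hi
  by_cases hKI : K ≤ I
  · have h1 := hsum hi le_rfl
    linarith [hint i K hi hKI]
  · have hIK : I ≤ K := (not_le.mp hKI).le
    have htf := backOrbit_tail_floor hγ hC hz hρ htail ((le_add_of_nonneg_right hDent).trans hfloor)
    by_cases hiI : I ≤ i
    · exact le_trans (le_min (by linarith) ((le_add_of_nonneg_right hDent).trans hfloor)) (htf i hiI hi)
    · have h1 := hsum (not_le.mp hiI).le hIK
      have h2 := htf I le_rfl hIK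
      have h3 : 1 / γ ^ 2 + Dent ≤ min (z K) ((C / ρ) ^ 2) := le_min hYt' hfloor
      linarith [hent i (not_le.mp hiI).le]

end Orbit

/-! ## §2 Possibility on the linear road from the FLOOR–ENTRY condition; recovering sequences -/

section Possible

variable {b : ℕ → ℝ} {C : ℝ}

/-- **E FROM THE FLOOR–ENTRY CONDITION** · if for every level `A > 0` the one-loop sequence `b` admits a checkpoint `I`, a tail rate `ρ > 0`
(`b_j ≥ −ρ`, `j ≥ I`), internal and entry drawdown bounds `Dint`, `Dent` on `[0, I]`, with `A + Dent ≤ (C∕ρ)²`, then EVERY forward-generated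
construction of the linear cooperator `b_k + C g_k` (`C > 0`) has `EndpointExistence` (`γ₂ = 1`, `1∕g⋆(γ)² = 1∕γ² + Dint + Dent`).  Unifies the
quadratic-profile cooperator of (PD) in spirit (small tail rate against entry drawdown) with RECOVERIES (entry drawdown reset at checkpoints).
[cite: Balaban1987RG1, Thm 2 p.259 (first sentence) and (0.20) p.256] -/
theorem endpointExistence_linCoop_of_floorEntry (hC : 0 < C)
    (h : ∀ A : ℝ, 0 < A → ∃ (I : ℕ) (ρ Dint Dent : ℝ), 0 < ρ ∧ (∀ j, I ≤ j → -ρ ≤ b j) ∧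
      (∀ i K', i ≤ K' → K' ≤ I → -Dint ≤ ∑ j ∈ Ico i K', b j) ∧ (∀ i, i ≤ I → -Dent ≤ ∑ j ∈ Ico i I, b j) ∧ A + Dent ≤ (C / ρ) ^ 2)
    {β : HBeta} (hβ : ∀ (k : ℕ) (p : Fin (k + 1) → ℝ), 0 < p (Fin.last k) → β k p = b k + C * p (Fin.last k))
    {Cn : B12.Construction} (hgen : ForwardGenerated Cn β) : EndpointExistence Cn := by
  intro m
  refine ⟨1, one_pos, fun γ hγ _ => ?_⟩
  obtain ⟨I, ρ, Dint, Dent, hρ, htail, hint, hent, hfloor⟩ := h (1 / γ ^ 2) (by positivity)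
  have hDint : 0 ≤ Dint := by have h := hint 0 0 le_rfl (Nat.zero_le I); simp at h; linarith
  have hDent : 0 ≤ Dent := by have h := hent I le_rfl; simp at h; linarith
  set Ystar : ℝ := 1 / γ ^ 2 + Dint + Dent with hYstar
  have hYpos : 0 < Ystar := by positivity
  refine ⟨1 / Real.sqrt Ystar, by positivity, fun g hg hgle K => ?_⟩
  have hYt : Ystar ≤ 1 / g ^ 2 := by
    have h1 : g ^ 2 ≤ (1 / Real.sqrt Ystar) ^ 2 := pow_le_pow_left₀ hg.le hgle 2
    rw [div_pow, one_pow, Real.sq_sqrt hYpos.le] at h1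
    calc Ystar = 1 / (1 / Ystar) := (one_div_one_div Ystar).symm
      _ ≤ 1 / g ^ 2 := one_div_le_one_div_of_le (pow_pos hg 2) h1
  have hgγ : g ≤ γ := by
    have h1 : 1 / γ ^ 2 ≤ 1 / g ^ 2 := by linarith
    have h2 : g ^ 2 ≤ γ ^ 2 := (one_div_le_one_div (pow_pos hγ 2) (pow_pos hg 2)).mp h1
    exact (pow_le_pow_iff_left₀ hg.le hγ.le two_ne_zero).mp h2
  obtain ⟨z, hzK, hz⟩ := exists_backOrbit (b := b) (H := fun x => C * x) hγ (continuousOn_linHelp C γ)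
    (monotoneOn_linHelp hC.le γ) K (1 / g ^ 2)
  have hA := backOrbit_ge_clamp_of_floorEntry hγ hC hz hρ htail hint hent hfloor (by rw [hzK]; linarith) (by rw [hzK]; linarith)
  obtain ⟨g0, hI, hK, -⟩ := run_of_backOrbit (H := fun x => C * x) hβ hγ hgen hg hgγ m hzK hz hA
  exact ⟨g0, hI, hK⟩

/-- **POSSIBLE ON THE LINEAR ROAD FROM THE FLOOR–ENTRY CONDITION** (`C > 0`, every box).
[cite: Balaban1987RG1, Thm 2 p.259 (first sentence) and (2.12)–(2.14) p.268] -/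
theorem endPossibleLin_of_floorEntry (hC : 0 < C) {γ₀ : ℝ} (hγ₀ : 0 < γ₀)
    (h : ∀ A : ℝ, 0 < A → ∃ (I : ℕ) (ρ Dint Dent : ℝ), 0 < ρ ∧ (∀ j, I ≤ j → -ρ ≤ b j) ∧
      (∀ i K', i ≤ K' → K' ≤ I → -Dint ≤ ∑ j ∈ Ico i K', b j) ∧ (∀ i, i ≤ I → -Dent ≤ ∑ j ∈ Ico i I, b j) ∧ A + Dent ≤ (C / ρ) ^ 2) :
    EndPossibleLin b C γ₀ :=
  (endPossibleLin_iff_modelOf hC.le hγ₀).mpr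
    (endpointExistence_linCoop_of_floorEntry hC h (fun k _ hp => betaLin_of_pos b C k hp) (modelOf_forwardGenerated _))

/-- **RECOVERING SEQUENCES ARE POSSIBLE ON EVERY LINEAR ROAD** · if `liminf b ≥ 0` (for every `ε > 0`, eventually `b_j ≥ −ε`) and `b` RECOVERS
infinitely often within a FIXED budget `B` (beyond every `N` there is a checkpoint `n` whose entry windows satisfy `Σ_{[i,n)} b ≥ −B`), then
`EndPossibleLin b C γ₀` for EVERY `C > 0` and every box — whatever the size of the drawdown profile of `b`. [cite: Balaban1987RG1, Thm 2 p.259 (first sentence) and (2.12)–(2.14) p.268] -/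
theorem endPossibleLin_of_recovering (hC : 0 < C) {γ₀ : ℝ} (hγ₀ : 0 < γ₀) (hlim : ∀ ε : ℝ, 0 < ε → ∃ N : ℕ, ∀ j, N ≤ j → -ε ≤ b j)
    {B : ℝ} (hchk : ∀ N : ℕ, ∃ n, N ≤ n ∧ ∀ i, i ≤ n → -B ≤ ∑ j ∈ Ico i n, b j) : EndPossibleLin b C γ₀ := by
  refine endPossibleLin_of_floorEntry hC hγ₀ fun A hA => ?_
  have hB : 0 ≤ B := by obtain ⟨n, -, hn⟩ := hchk 0; have h := hn n le_rfl; simp at h; linarith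
  set ρ : ℝ := C / Real.sqrt (A + B) with hρ
  have hρpos : 0 < ρ := by positivity
  obtain ⟨N, hN⟩ := hlim ρ hρpos
  obtain ⟨n, hNn, hn⟩ := hchk N
  refine ⟨n, ρ, ∑ j ∈ range n, |b j|, B, hρpos, fun j hj => hN j (hNn.trans hj), fun i K' hiK hKn => ?_, hn, ?_⟩
  · have h1 : |∑ j ∈ Ico i K', b j| ≤ ∑ j ∈ Ico i K', |b j| := Finset.abs_sum_le_sum_abs _ _
    have h2 : ∑ j ∈ Ico i K', |b j| ≤ ∑ j ∈ range n, |b j| :=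
      Finset.sum_le_sum_of_subset_of_nonneg (fun j hj => by simp only [mem_Ico] at hj; simp only [mem_range]; omega)
        fun _ _ _ => abs_nonneg _
    linarith [neg_abs_le (∑ j ∈ Ico i K', b j)]
  · rw [hρ, div_div_cancel₀ hC.ne', Real.sq_sqrt (by positivity)]

end Possible

end

end Summit.QuantumFields.BalabanUV.Gaps.EndDrawdownLinearFloorEntry
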